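import Summits.BirchSwinnertonDyer.BirchSwinnertonDyer.Theses.ResidualThetaTransportAtTwo
import Summits.BirchSwinnertonDyer.BirchSwinnertonDyer.Theorems.ResidualThetaTransportAtTwoRlfOfTwistedEventualLevelDescent
import Summits.BirchSwinnertonDyer.BirchSwinnertonDyer.Theorems.ResidualThetaTransportAtTwoRlfTwistedAmbientGeneric
import Summits.BirchSwinnertonDyer.BirchSwinnertonDyer.Theorems.ResidualThetaTransportAtTwoRlfTwistedLiftPlusTwoOfEventual
import Summits.BirchSwinnertonDyer.BirchSwinnertonDyer.Theorems.ResidualThetaTransportAtTwoRlfTwistedEventualPlusLiftAlt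
import HarnessLib

/-!
# Item 23110 `ResidualLambdaFormulaNegDiscAtTwo` BY NAME from PRINT {weak Leopoldt at `2`, Prop. 4.12} + H-PLUSDUAL-alt(u) ∧ H-FIN(u) ONLY
# — the door keyed to the lead's FINAL `±`-duality binder (alternating + non-degenerate Weil data, 20:10Z; providers
# `TwistedPT.hlevEventual_two_of_plusDualAlt_of_eigen`, `TwistedPT.liftPlusEventual_two_of_plusDualAlt_of_eigen`)

Route `ResidualThetaTransportAtTwo` (RTT, crux r201, stmt-BirchSwinnertonDyer-23110) / `ThetaPartnerAtTwo` (TP2, aside r205). Seat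
`prover-bsd-wall-tp2-p2x-w3` g12; `--supports stmt-BirchSwinnertonDyer-23110`. THEOREMS ONLY; LEAF file (imports the route file and
route-independent helpers only — a sibling of the doors p660161 / p661485 / `…RlfOfLiftEventualDoor`, not built on them).

* `residualLambdaFormulaNegDiscAtTwo_of_print_of_plusDualAlt_of_eigen` — (hWL) → (h412) → «for every (κ, γ, S₀, E) of the branch and
  every `+` dual datum `D` with `X⁺` f.g. torsion, `μ = 0`: ∃ B finite, ∀ odd u ∉ B, H-PLUSDUAL-alt(u) ∧ H-FIN(u)» →
  **`Theses.ResidualThetaTransportAtTwo.ResidualLambdaFormulaNegDiscAtTwo`** BY NAME (`c = 0`): `u` outside `B` and the exceptional set of (ii)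
  (`TwistedSurj.exists_twistedCoinv_H1Sigma_of_print`); (LIFT⁺₂)(u) := `TwistedPT.liftPlusTwo_of_liftPlusEventual` ∘
  `liftPlusEventual_two_of_plusDualAlt_of_eigen`; (TCAS-K)_ev(u) := `hlevEventual_two_of_plusDualAlt_of_eigen`; then
  `rlf2_of_twistedEventualLevelDescent`. Binders `hdual` (WITH `halt`, `hnondeg`) / `hfinE` VERBATIM those of the providers at `ε = 1`.
* `residualLambdaFormulaNegDiscAtTwo_TP2_of_print_of_plusDualAlt_of_eigen` — the same for the TP2 decl.

STATE OF 23110 AFTER THIS FILE: every rank ⟸ PRINT {WL@2, Prop. 4.12} (route binders) + H-PLUSDUAL-alt(u) [seat w2: B. D. Kim 2007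
Prop. 3.18 read at `2`, twisted, level `ℚ`, for alternating non-degenerate Weil data] + H-FIN(u) [the lead] for generic odd `u`.
HONEST FRAMING: CONDITIONAL; closes nothing; 23110 is NOT proved; BSD is not proved by any of this.
References: [GreenbergLNM1716] §4 Props. 4.12–4.14 (pp. 119–124); [GreenbergVatsal2000] §2 Prop. (2.1), (10); [BDKim2013] Thm. 1.1;
B. D. Kim, Compositio Math. 143 (2007), Props. 3.15–3.18; [Kobayashi2003] Def. 1.1.
-/

set_option autoImplicit false
set_option linter.dupNamespace false

noncomputable section

open scoped Classical NumberField AddSubgroup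

open NumberField IsDedekindDomain Field

namespace Summit.BirchSwinnertonDyer.BirchSwinnertonDyer.Theorems.SignedEC.TwistedLocalDescent

open Literature.NumberTheory.EllipticCurves Literature.NumberTheory.GaloisRepresentations
  Literature.NumberTheory.GaloisCohomology WeierstrassCurve ZpExtension Literature.NumberTheory.EllipticCurves.Kobayashi2003
  Literature.NumberTheory.EllipticCurves.GreenbergVatsal2000 Literature.NumberTheory.EllipticCurves.GreenbergSelmer
  Literature.NumberTheory.EllipticCurves.Rank1Residual

/-- **Item 23110 BY NAME from print + H-PLUSDUAL-alt(u) ∧ H-FIN(u) for generic odd `u` — nothing else displayed.** Binders VERBATIM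
those of the lead's `TwistedPT.hlevEventual_two_of_plusDualAlt_of_eigen` / `liftPlusEventual_two_of_plusDualAlt_of_eigen` at `ε = 1`.
CONDITIONAL; closes nothing. [cite: GreenbergLNM1716, §4 Props. 4.12–4.14 (pp. 119–124)] [cite: GreenbergVatsal2000, §2 Prop. (2.1) and (10)]
[cite: BDKim2013, Thm. 1.1] -/
theorem residualLambdaFormulaNegDiscAtTwo_of_print_of_plusDualAlt_of_eigen
    (hWL : Greenberg1999.h1SigmaInfty_rank_eq_one)
    (h412 : Greenberg1999.prop412_noFiniteSubmodule_H1Sigma_of_rank_one)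
    (hDF : ∀ (κ : ZpExtension ℚ 2) (γ : Field.absoluteGaloisGroup ℚ), κ.IsCyclotomic → κ.IsTopGenerator γ →
      ∀ (S₀ : Finset (HeightOneSpectrum (𝓞 ℚ))), (∀ v ∈ S₀, ((2 : ℕ) : 𝓞 ℚ) ∉ v.asIdeal) →
      ∀ (E : WeierstrassCurve ℚ) [E.IsElliptic] [E.IsGloballyMinimal], GoodSS E 2 → E.frobeniusTrace 2 = 0 → E.Δ < 0 →
        (∀ v : HeightOneSpectrum (𝓞 ℚ), ¬ E.HasGoodReductionAt v → v ∈ S₀) →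
      ∀ (D : SignedSelmerDualData E κ γ 1) [Module.Finite (IwasawaAlgebra 2) D.X],
        Module.IsTorsion (IwasawaAlgebra 2) D.X → D.mu = 0 →
      ∃ B : Set ℤ, B.Finite ∧ ∀ u : ℤ, u ∉ B → ∀ hu : (2 : ℤ) ∣ u - 1,
        (∀ (J : ℕ) (u' : ℤ) (hu' : (2 : ℤ) ∣ u' - 1) (huu' : ((2 : ℤ) ^ J) ∣ u * u' - 1)
      (e : E.geomTorsion ((2 ^ J : ℕ) : ℤ) → E.geomTorsion ((2 ^ J : ℕ) : ℤ) → AlgebraicClosure ℚ)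
      (hμ : ∀ S T, e S T ^ (2 ^ J) = 1) (hadd₁ : ∀ S₁ S₂ T, e (S₁ + S₂) T = e S₁ T * e S₂ T)
      (hadd₂ : ∀ S T₁ T₂, e S (T₁ + T₂) = e S T₁ * e S T₂)
      (hgal : ∀ (σ : absoluteGaloisGroup ℚ) (S T : E.geomTorsion ((2 ^ J : ℕ) : ℤ)), σ • e S T = e (σ • S) (σ • T))
      (halt : ∀ T, e T T = 1) (hnondeg : ∀ T, (∀ S, e S T = 1) → T = 0)
      [Finite (E.geomTorsion ((2 ^ J : ℕ) : ℤ))]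
      (inv : LocalInvariants ℚ (2 ^ J)), inv.IsPerfect → inv.SumLocalTermEqZero → inv.UnramifiedOrthogonal →
      ∀ (v : HeightOneSpectrum (𝓞 ℚ)), ((2 : ℕ) : 𝓞 ℚ) ∈ v.asIdeal →
      ∀ y' : galoisCohomology ((E.twistedTorsionGaloisModule 2 κ J u' hu').restrictField (v.adicCompletion ℚ)) 1,
        galoisCohomology.map ((E.twistedWeilDual 2 κ J hu hu' huu' e hμ hadd₁ hadd₂ hgal).restrictField (v.adicCompletion ℚ)) 1 y' ∈
            inv.dualLocalCondition (E.twistedTorsionGaloisModule 2 κ J u hu) (Sum.inr v)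
              (E.twistedTorsionLocalKummer 2 κ J u hu (v.adicCompletion ℚ)
                (⨆ n : ℕ, signedLocalPoints κ (v.adicCompletion ℚ) E 1 n)) →
        y' ∈ E.twistedTorsionLocalKummer 2 κ J u' hu' (v.adicCompletion ℚ) (⨆ n : ℕ, signedLocalPoints κ (v.adicCompletion ℚ) E 1 n)) ∧
        (∃ e : ℕ, ∀ c ∈ unramifiedOutside κ.kerSubgroup ↥(E.geomPrimaryTorsion 2) 2 (↑S₀ : Set (HeightOneSpectrum (𝓞 ℚ))) ⊓
        ⨅ (v : HeightOneSpectrum (𝓞 ℚ)) (_ : ((2 : ℕ) : 𝓞 ℚ) ∈ v.asIdeal) (σ : Field.absoluteGaloisGroup ℚ),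
          (localKummerOverOfEmb E 2 κ.kerSubgroup (closureEmb (K := ℚ) (v.adicCompletion ℚ))
            (⨆ n : ℕ, signedLocalPoints κ (v.adicCompletion ℚ) E 1 n)).comap (E.conjH1 2 κ.kerSubgroup σ),
      E.conjH1 2 κ.kerSubgroup γ c = u • c → 2 ^ e • c = 0)) :
    Summit.BirchSwinnertonDyer.BirchSwinnertonDyer.Theses.ResidualThetaTransportAtTwo.ResidualLambdaFormulaNegDiscAtTwo := by
  intro κ γ hκ hγ S₀ hS2
  refine ⟨0, fun E _ _ hss ha hΔ hS D _ hX hμ ↦ ?_⟩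
  obtain ⟨B, hB, hDFu⟩ := hDF κ γ hκ hγ S₀ hS2 E hss ha hΔ hS D hX hμ
  have hgood : ∀ v : HeightOneSpectrum (𝓞 ℚ), v ∉ S₀ → ((2 : ℕ) : 𝓞 ℚ) ∉ v.asIdeal → E.HasGoodReductionAt v :=
    fun v hv _ ↦ by by_contra hng; exact hv (hS v hng)
  obtain ⟨u, huB, hu, hH⟩ := TwistedSurj.exists_twistedCoinv_H1Sigma_of_print hWL h412 E 2 κ γ hκ hγ S₀ hgood B hB
  have hu' : (2 : ℤ) ∣ u - 1 := by exact_mod_cast hu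
  obtain ⟨hdual, hfinE⟩ := hDFu u huB hu'
  simpa only [Nat.add_zero] using
    rlf2_of_twistedEventualLevelDescent κ γ hκ hγ S₀ hS2 E hss ha hΔ hS D hX hμ (u := u) (by exact_mod_cast hu') hH
      (TwistedPT.liftPlusTwo_of_liftPlusEventual E hss ha S₀ κ hκ hγ u hu'
        (fun J x₂ ↦ TwistedPT.liftPlusEventual_two_of_plusDualAlt_of_eigen E hss S₀ κ hγ u hu' 1 hS2 hS hdual hfinE J x₂))
      (fun J t ↦ TwistedPT.hlevEventual_two_of_plusDualAlt_of_eigen E hss S₀ κ hγ u hu' 1 hS2 hS hdual hfinE J t)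

/-- **The same for the TP2 decl** `Theses.ThetaPartnerAtTwo.ResidualLambdaFormulaNegDiscAtTwo` (identical text).
[cite: GreenbergLNM1716, §4 Props. 4.12–4.14 (pp. 119–124)] [cite: GreenbergVatsal2000, §2 Prop. (2.1) and (10)] -/
theorem residualLambdaFormulaNegDiscAtTwo_TP2_of_print_of_plusDualAlt_of_eigen
    (hWL : Greenberg1999.h1SigmaInfty_rank_eq_one)
    (h412 : Greenberg1999.prop412_noFiniteSubmodule_H1Sigma_of_rank_one)
    (hDF : ∀ (κ : ZpExtension ℚ 2) (γ : Field.absoluteGaloisGroup ℚ), κ.IsCyclotomic → κ.IsTopGenerator γ →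
      ∀ (S₀ : Finset (HeightOneSpectrum (𝓞 ℚ))), (∀ v ∈ S₀, ((2 : ℕ) : 𝓞 ℚ) ∉ v.asIdeal) →
      ∀ (E : WeierstrassCurve ℚ) [E.IsElliptic] [E.IsGloballyMinimal], GoodSS E 2 → E.frobeniusTrace 2 = 0 → E.Δ < 0 →
        (∀ v : HeightOneSpectrum (𝓞 ℚ), ¬ E.HasGoodReductionAt v → v ∈ S₀) →
      ∀ (D : SignedSelmerDualData E κ γ 1) [Module.Finite (IwasawaAlgebra 2) D.X],
        Module.IsTorsion (IwasawaAlgebra 2) D.X → D.mu = 0 →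
      ∃ B : Set ℤ, B.Finite ∧ ∀ u : ℤ, u ∉ B → ∀ hu : (2 : ℤ) ∣ u - 1,
        (∀ (J : ℕ) (u' : ℤ) (hu' : (2 : ℤ) ∣ u' - 1) (huu' : ((2 : ℤ) ^ J) ∣ u * u' - 1)
      (e : E.geomTorsion ((2 ^ J : ℕ) : ℤ) → E.geomTorsion ((2 ^ J : ℕ) : ℤ) → AlgebraicClosure ℚ)
      (hμ : ∀ S T, e S T ^ (2 ^ J) = 1) (hadd₁ : ∀ S₁ S₂ T, e (S₁ + S₂) T = e S₁ T * e S₂ T)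
      (hadd₂ : ∀ S T₁ T₂, e S (T₁ + T₂) = e S T₁ * e S T₂)
      (hgal : ∀ (σ : absoluteGaloisGroup ℚ) (S T : E.geomTorsion ((2 ^ J : ℕ) : ℤ)), σ • e S T = e (σ • S) (σ • T))
      (halt : ∀ T, e T T = 1) (hnondeg : ∀ T, (∀ S, e S T = 1) → T = 0)
      [Finite (E.geomTorsion ((2 ^ J : ℕ) : ℤ))]
      (inv : LocalInvariants ℚ (2 ^ J)), inv.IsPerfect → inv.SumLocalTermEqZero → inv.UnramifiedOrthogonal →
      ∀ (v : HeightOneSpectrum (𝓞 ℚ)), ((2 : ℕ) : 𝓞 ℚ) ∈ v.asIdeal →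
      ∀ y' : galoisCohomology ((E.twistedTorsionGaloisModule 2 κ J u' hu').restrictField (v.adicCompletion ℚ)) 1,
        galoisCohomology.map ((E.twistedWeilDual 2 κ J hu hu' huu' e hμ hadd₁ hadd₂ hgal).restrictField (v.adicCompletion ℚ)) 1 y' ∈
            inv.dualLocalCondition (E.twistedTorsionGaloisModule 2 κ J u hu) (Sum.inr v)
              (E.twistedTorsionLocalKummer 2 κ J u hu (v.adicCompletion ℚ)
                (⨆ n : ℕ, signedLocalPoints κ (v.adicCompletion ℚ) E 1 n)) →
        y' ∈ E.twistedTorsionLocalKummer 2 κ J u' hu' (v.adicCompletion ℚ) (⨆ n : ℕ, signedLocalPoints κ (v.adicCompletion ℚ) E 1 n)) ∧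
        (∃ e : ℕ, ∀ c ∈ unramifiedOutside κ.kerSubgroup ↥(E.geomPrimaryTorsion 2) 2 (↑S₀ : Set (HeightOneSpectrum (𝓞 ℚ))) ⊓
        ⨅ (v : HeightOneSpectrum (𝓞 ℚ)) (_ : ((2 : ℕ) : 𝓞 ℚ) ∈ v.asIdeal) (σ : Field.absoluteGaloisGroup ℚ),
          (localKummerOverOfEmb E 2 κ.kerSubgroup (closureEmb (K := ℚ) (v.adicCompletion ℚ))
            (⨆ n : ℕ, signedLocalPoints κ (v.adicCompletion ℚ) E 1 n)).comap (E.conjH1 2 κ.kerSubgroup σ),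
      E.conjH1 2 κ.kerSubgroup γ c = u • c → 2 ^ e • c = 0)) :
    Summit.BirchSwinnertonDyer.BirchSwinnertonDyer.Theses.ThetaPartnerAtTwo.ResidualLambdaFormulaNegDiscAtTwo :=
  residualLambdaFormulaNegDiscAtTwo_of_print_of_plusDualAlt_of_eigen hWL h412 hDF

end Summit.BirchSwinnertonDyer.BirchSwinnertonDyer.Theorems.SignedEC.TwistedLocalDescent

end
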